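import Summits.ResolutionOfSingularities.ResolutionOfSingularities.Theorems.WeightedInvariantIota3FlagBridge
import HarnessLib

/-!
# Sketch-R9 [OURS · L1 w43 · idea-2 gen 9] — «σ₁ is Hironaka's δ»: one-flag collapse, monotonicity in `q`,
the tangent-cone dichotomy, the δ-certificate (typed candidate), and the arithmetic core of the (o56)(b′) successor bound

Evidence for `stmt-ResolutionOfSingularities-0571` (crux `WeightedConstruction`), bearing on the door item
`stmt-ResolutionOfSingularities-19897` (`HypersurfaceCentreConstruction`, skeleton v3.10 rev 3) branch **(o56)(b′)**
(«ν, ε, τ tie and the σ-RATIO drops at the t-homogeneous successor prime»).  Nothing here is a Literature fact; every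
`def … : Prop` marked CANDIDATE is OURS and unproved.  AI-written, not expert-reviewed.

* §1 `flagContactFiltration` is MONOTONE in `q` (`flagContactFiltration_mono_q`, proved) — so the sup defining `sigmaRatioNat`
  is attained at the largest admissible `q`, namely `q = r₂`.
* §2 ONE-FLAG COLLAPSE (proved): at `q = r₂` the second flag member is absorbed by the `𝔪`-power,
  `flagContactFiltration g₁ g₂ r₂ r₁ r₂ n = ratContactFiltration g₁ r₁ r₂ n := ⨆ α, (g₁^α)·𝔪^⌈(n − r₁α)/r₂⌉` for `g₂ ∈ 𝔪`;
  hence `FlagReaches f ν q r₁ r₂ → OneFlagReaches f ν r₁ r₂` for admissible triples: **σ₁/ν! = sup over ONE regular parameter g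
  of the rational contact exponent of f along the hypersurface germ g** (= Hironaka's `δ(f; u; g)` maximised over `g`, i.e. the
  `δ` of the characteristic polyhedron — R9-B of IDEAS.md §ROUND 9).
* §3 TANGENT-CONE DICHOTOMY (proved): `ratContactFiltration g a b (aν) ≤ (g^ν) ⊔ 𝔪^(ν+1)` when `b < a`; so a ratio `> 1`
  along `g` forces `f ≡ c·g^ν (mod 𝔪^(ν+1))` — at most ONE tangent direction can carry ratio `> 1`.
* §4 the δ-CERTIFICATE (CANDIDATE, typed): non-solvability of the δ-face initial form in ONE frame bounds `σ₁` from above; its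
  lower-bound half `certificate_lowerBound` is PROVED from the tree's bridge `flagReaches_of_mem_weightedMonomialIdeal`.
* §6 (G4) the DIMENSION-2 BRIDGE at η (proved): `flagReaches_of_mem_weightedMonomialIdeal₂`, `ratioScale_mul_le_sigmaRatioNat_mul`.
* §5 the ARITHMETIC CORE of (b′) (proved): the τ = 0 witness point lands strictly below `1 + frac(r/q)` at the successor, a
  would-be canceller of a minimal low point is itself a lower witness («low points are translation-rigid»), and the `sSup` bookkeeping
  `sigmaRatioNat_mul_lt_of_slope_lt` + `sigma_ratio_drop_of_bounds` turning the slope bound into the STRICT drop of the letter.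
-/

noncomputable section

open IsLocalRing Literature.AlgebraicGeometry.Resolution

set_option linter.dupNamespace false

namespace Summit.ResolutionOfSingularities.ResolutionOfSingularities.Cruxes.HypersurfaceCentreConstruction.LocalEngine

namespace Iota3

namespace R9

universe u

variable {S : Type u} [CommRing S] [IsLocalRing S]

/-! ## §1 Monotonicity in `q` -/

/-- Ceilings decrease as the denominator grows: `⌈N/q'⌉ ≤ ⌈N/q⌉` for `0 < q ≤ q'` (in `ℕ`-arithmetic). [folklore] -/
theorem ceilDiv_anti {N q q' : ℕ} (hq : 0 < q) (hqq' : q ≤ q') : (N + q' - 1) / q' ≤ (N + q - 1) / q := by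
  have hq' : 0 < q' := lt_of_lt_of_le hq hqq'
  obtain ⟨k, hk⟩ : ∃ k, k = (N + q - 1) / q := ⟨_, rfl⟩
  rw [← hk]
  have h1 : N ≤ k * q := by
    have := Nat.lt_div_mul_add (a := N + q - 1) hq
    rw [← hk] at this
    omega
  have h2 : k * q ≤ k * q' := Nat.mul_le_mul_left k hqq'
  apply Nat.le_of_lt_succ
  rw [Nat.div_lt_iff_lt_mul hq']
  have h3 : (k + 1) * q' = k * q' + q' := by ring
  rw [Nat.succ_eq_add_one, h3]
  omega

/-- [OURS · R9-B1] `flagContactFiltration` is monotone in `q`: a larger `q` means smaller weights `r₁/q, r₂/q` on the flag,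
hence smaller `𝔪`-exponents `⌈(n − r₁α − r₂β)/q⌉`, hence a LARGER ideal. [folklore] -/
theorem flagContactFiltration_mono_q (g₁ g₂ : S) {q q' : ℕ} (hq : 0 < q) (hqq' : q ≤ q') (r₁ r₂ n : ℕ) :
    flagContactFiltration g₁ g₂ q r₁ r₂ n ≤ flagContactFiltration g₁ g₂ q' r₁ r₂ n := by
  rw [flagContactFiltration_def, flagContactFiltration_def]
  refine iSup_le fun α => iSup_le fun β => le_iSup_of_le α (le_iSup_of_le β ?_)
  exact Ideal.mul_mono_right (Ideal.pow_le_pow_right (ceilDiv_anti hq hqq'))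

/-- [OURS · R9-B1] Reaching is monotone in `q`. [folklore] -/
theorem FlagReaches.mono_q {f : S} {ν q q' r₁ r₂ : ℕ} (hq : 0 < q) (hqq' : q ≤ q') (h : FlagReaches f ν q r₁ r₂) :
    FlagReaches f ν q' r₁ r₂ := by
  obtain ⟨g₁, g₂, hfl, hf⟩ := h
  exact ⟨g₁, g₂, hfl, flagContactFiltration_mono_q g₁ g₂ hq hqq' r₁ r₂ _ hf⟩

/-! ## §2 The one-flag collapse at `q = r₂` -/

/-- [OURS · R9-B1] The **rational one-flag contact filtration** of weight `a/b` along `g`: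
degree `n` is `⨆_α (g^α) · 𝔪^⌈(n − aα)/b⌉` — the monomials `u^γ g^α` with `|γ| + (a/b)α ≥ n/b`.
For `b = 1` it is 092's `contactFiltration g a`.  A predicate of the line, not a cited statement. -/
def ratContactFiltration (g : S) (a b n : ℕ) : Ideal S :=
  ⨆ α : ℕ, Ideal.span {g ^ α} * maximalIdeal S ^ ((n - a * α + b - 1) / b)

/-- The `rfl` unfolding. [folklore] -/
theorem ratContactFiltration_def (g : S) (a b n : ℕ) :
    ratContactFiltration g a b n = ⨆ α : ℕ, Ideal.span {g ^ α} * maximalIdeal S ^ ((n - a * α + b - 1) / b) := rfl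

/-- The ceiling bookkeeping of the collapse: with `q ≤ r₂` and `e = ⌈(N − r₂β)/q⌉` one has `⌈N/r₂⌉ ≤ β + e`. [folklore] -/
theorem ceil_collapse {N q r₂ β : ℕ} (hq : 0 < q) (hqr : q ≤ r₂) :
    (N + r₂ - 1) / r₂ ≤ β + (N - r₂ * β + q - 1) / q := by
  have hr : 0 < r₂ := lt_of_lt_of_le hq hqr
  obtain ⟨e, he⟩ : ∃ e, e = (N - r₂ * β + q - 1) / q := ⟨_, rfl⟩
  rw [← he]
  have h1 : N - r₂ * β ≤ e * q := by
    have := Nat.lt_div_mul_add (a := N - r₂ * β + q - 1) hq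
    rw [← he] at this
    omega
  have h2 : e * q ≤ e * r₂ := Nat.mul_le_mul_left e hqr
  apply Nat.le_of_lt_succ
  rw [Nat.div_lt_iff_lt_mul hr]
  have h3 : (β + e + 1) * r₂ = r₂ * β + e * r₂ + r₂ := by ring
  rw [Nat.succ_eq_add_one, h3]
  omega

/-- [OURS · R9-B1] **One-flag collapse, `≤`**: for `g₂ ∈ 𝔪` and `0 < q ≤ r₂` the two-flag filtration lies in the rational
one-flag filtration of `g₁` — the factor `g₂^β` is worth at least `𝔪^β`, and `β + ⌈(N − r₂β)/q⌉ ≥ ⌈N/r₂⌉`. [folklore] -/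
theorem flagContactFiltration_le_ratContactFiltration {g₁ g₂ : S} (hg₂ : g₂ ∈ maximalIdeal S) {q r₁ r₂ : ℕ}
    (hq : 0 < q) (hqr : q ≤ r₂) (n : ℕ) :
    flagContactFiltration g₁ g₂ q r₁ r₂ n ≤ ratContactFiltration g₁ r₁ r₂ n := by
  rw [flagContactFiltration_def, ratContactFiltration_def]
  refine iSup_le fun α => iSup_le fun β => le_iSup_of_le α ?_
  have hpow : g₂ ^ β ∈ maximalIdeal S ^ β := Ideal.pow_mem_pow hg₂ β
  calc Ideal.span {g₁ ^ α * g₂ ^ β} * maximalIdeal S ^ ((n - r₁ * α - r₂ * β + q - 1) / q)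
      = Ideal.span {g₁ ^ α} * (Ideal.span {g₂ ^ β} * maximalIdeal S ^ ((n - r₁ * α - r₂ * β + q - 1) / q)) := by
        rw [← Ideal.span_singleton_mul_span_singleton, mul_assoc]
    _ ≤ Ideal.span {g₁ ^ α} * (maximalIdeal S ^ β * maximalIdeal S ^ ((n - r₁ * α - r₂ * β + q - 1) / q)) :=
        Ideal.mul_mono_right (Ideal.mul_mono_left ((Ideal.span_singleton_le_iff_mem _).mpr hpow))
    _ ≤ Ideal.span {g₁ ^ α} * maximalIdeal S ^ ((n - r₁ * α + r₂ - 1) / r₂) := by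
        refine Ideal.mul_mono_right ?_
        rw [← pow_add]
        exact Ideal.pow_le_pow_right (ceil_collapse (N := n - r₁ * α) hq hqr)

/-- [OURS · R9-B1] **One-flag collapse, `≥`**: the rational one-flag filtration is the `β = 0` part of the two-flag filtration
at `q = r₂`. [folklore] -/
theorem ratContactFiltration_le_flagContactFiltration (g₁ g₂ : S) (r₁ r₂ n : ℕ) :
    ratContactFiltration g₁ r₁ r₂ n ≤ flagContactFiltration g₁ g₂ r₂ r₁ r₂ n := by
  rw [flagContactFiltration_def, ratContactFiltration_def]
  refine iSup_le fun α => le_iSup_of_le α (le_iSup_of_le 0 ?_)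
  rw [pow_zero, mul_one, Nat.mul_zero, Nat.sub_zero]

/-- [OURS · R9-B1] **One-flag collapse, `=`** at `q = r₂` (for `g₂ ∈ 𝔪`, `0 < r₂`). [folklore] -/
theorem flagContactFiltration_eq_ratContactFiltration {g₁ g₂ : S} (hg₂ : g₂ ∈ maximalIdeal S) {r₁ r₂ : ℕ}
    (hr : 0 < r₂) (n : ℕ) : flagContactFiltration g₁ g₂ r₂ r₁ r₂ n = ratContactFiltration g₁ r₁ r₂ n :=
  le_antisymm (flagContactFiltration_le_ratContactFiltration hg₂ hr le_rfl n)
    (ratContactFiltration_le_flagContactFiltration g₁ g₂ r₁ r₂ n)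

/-- [OURS · R9-B1] `f` (of order `ν`) reaches the rational weight `a/b` along ONE regular parameter `g`. A predicate of the
line, not a cited statement. -/
def OneFlagReaches (f : S) (ν a b : ℕ) : Prop :=
  ∃ g : S, g ∈ maximalIdeal S ∧ g ∉ maximalIdeal S ^ 2 ∧ f ∈ ratContactFiltration g a b (a * ν)

/-- [OURS · R9-B1] **The sup over two-flags is a sup over one regular parameter**: an admissible triple reached by a two-flag
is reached (same `r₁, r₂`) by its first member alone. [folklore] -/
theorem FlagReaches.oneFlagReaches {f : S} {ν q r₁ r₂ : ℕ} (hadm : AdmissibleTriple q r₁ r₂)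
    (h : FlagReaches f ν q r₁ r₂) : OneFlagReaches f ν r₁ r₂ := by
  obtain ⟨g₁, g₂, hfl, hf⟩ := h
  exact ⟨g₁, hfl.1, hfl.left_not_mem_sq, flagContactFiltration_le_ratContactFiltration hfl.2.1 hadm.1 hadm.2.1 _ hf⟩

/-- [OURS · R9-B1] Conversely a one-flag reach along `g` with ANY two-flag partner `g₂` is a two-flag reach at `q = b`.
[folklore] -/
theorem flagReaches_of_mem_ratContactFiltration {f g g₂ : S} {ν a b : ℕ} (hfl : IsTwoFlag g g₂)
    (h : f ∈ ratContactFiltration g a b (a * ν)) : FlagReaches f ν b a b :=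
  ⟨g, g₂, hfl, ratContactFiltration_le_flagContactFiltration g g₂ a b _ h⟩

/-! ## §3 The tangent-cone dichotomy -/

/-- The exponent bookkeeping: for `b < a`, `α < ν`: `ν + 1 ≤ α + ⌈a(ν − α)/b⌉`. [folklore] -/
theorem succ_le_add_ceil {a b ν α : ℕ} (hb : 0 < b) (hab : b < a) (hα : α < ν) :
    ν + 1 ≤ α + (a * ν - a * α + b - 1) / b := by
  obtain ⟨e, he⟩ : ∃ e, e = (a * ν - a * α + b - 1) / b := ⟨_, rfl⟩
  rw [← he]
  have hX1 : a * ν - a * α = a * (ν - α) := (mul_tsub a ν α).symm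
  have hX : (b + 1) * (ν - α) ≤ a * (ν - α) := Nat.mul_le_mul_right _ hab
  have hceil : a * ν - a * α + b - 1 < e * b + b := by
    have := Nat.lt_div_mul_add (a := a * ν - a * α + b - 1) hb
    rwa [← he] at this
  by_contra hlt
  have hlt' : α + e < ν + 1 := Nat.lt_of_not_le hlt
  have h4 : e * b ≤ (ν - α) * b := Nat.mul_le_mul_right _ (by omega)
  have h5 : (b + 1) * (ν - α) = (ν - α) * b + (ν - α) := by ring
  omega

/-- [OURS · R9-B1′] **Tangent-cone dichotomy**: for `g ∈ 𝔪` and `b < a`,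
`ratContactFiltration g a b (aν) ≤ (g^ν) ⊔ 𝔪^(ν+1)`: pieces with `α ≥ ν` are multiples of `g^ν`, pieces with `α < ν` lie in
`𝔪^(α + ⌈a(ν−α)/b⌉) ⊆ 𝔪^(ν+1)`.  Consequence: a contact ratio `> 1` along `g` forces `in_𝔪(f) = c · ḡ^ν`, so at most ONE tangent
hyperplane direction carries ratio `> 1` (the others have ratio exactly `1`). [folklore] -/
theorem ratContactFiltration_le_span_pow_sup {g : S} (hg : g ∈ maximalIdeal S) {a b : ℕ} (hb : 0 < b) (hab : b < a)
    (ν : ℕ) : ratContactFiltration g a b (a * ν) ≤ Ideal.span {g ^ ν} ⊔ maximalIdeal S ^ (ν + 1) := by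
  rw [ratContactFiltration_def]
  refine iSup_le fun α => ?_
  by_cases hα : ν ≤ α
  · refine le_sup_of_le_left ?_
    calc Ideal.span {g ^ α} * maximalIdeal S ^ ((a * ν - a * α + b - 1) / b) ≤ Ideal.span {g ^ α} := Ideal.mul_le_right
      _ ≤ Ideal.span {g ^ ν} := Ideal.span_singleton_le_span_singleton.mpr (pow_dvd_pow g hα)
  · have hα : α < ν := Nat.lt_of_not_le hα
    refine le_sup_of_le_right ?_
    calc Ideal.span {g ^ α} * maximalIdeal S ^ ((a * ν - a * α + b - 1) / b)
        ≤ maximalIdeal S ^ α * maximalIdeal S ^ ((a * ν - a * α + b - 1) / b) :=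
          Ideal.mul_mono_left ((Ideal.span_singleton_le_iff_mem _).mpr (Ideal.pow_mem_pow hg α))
      _ = maximalIdeal S ^ (α + (a * ν - a * α + b - 1) / b) := (pow_add _ _ _).symm
      _ ≤ maximalIdeal S ^ (ν + 1) := Ideal.pow_le_pow_right (succ_le_add_ceil hb hab hα)

/-- [OURS · R9-B1′] The dichotomy as an initial-form statement: `f ∈ ratContactFiltration g a b (aν)` with `b < a` gives
`f − c·g^ν ∈ 𝔪^(ν+1)` for some `c`. [folklore] -/
theorem exists_sub_mul_pow_mem_of_mem_ratContactFiltration {f g : S} (hg : g ∈ maximalIdeal S) {a b ν : ℕ}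
    (hb : 0 < b) (hab : b < a) (h : f ∈ ratContactFiltration g a b (a * ν)) :
    ∃ c : S, f - c * g ^ ν ∈ maximalIdeal S ^ (ν + 1) := by
  have h' := ratContactFiltration_le_span_pow_sup hg hb hab ν h
  rw [Submodule.mem_sup] at h'
  obtain ⟨y, hy, z, hz, hyz⟩ := h'
  obtain ⟨c, rfl⟩ := Ideal.mem_span_singleton'.mp hy
  exact ⟨c, by rwa [show f - c * g ^ ν = z by rw [← hyz]; ring]⟩

/-- [OURS · R9-B1′] Contrapositive, the form used at a successor point: if NO `c` makes `f − c·g^ν ∈ 𝔪^(ν+1)` (the tangent cone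
of `f` is not the `ν`-fold hyperplane `ḡ = 0`), then `g` reaches no weight `a/b > 1`. [folklore] -/
theorem not_mem_ratContactFiltration_of_tangent {f g : S} (hg : g ∈ maximalIdeal S) {a b ν : ℕ} (hb : 0 < b)
    (hab : b < a) (hne : ∀ c : S, f - c * g ^ ν ∉ maximalIdeal S ^ (ν + 1)) :
    f ∉ ratContactFiltration g a b (a * ν) := fun h => by
  obtain ⟨c, hc⟩ := exists_sub_mul_pow_mem_of_mem_ratContactFiltration hg hb hab h
  exact hne c hc

/-! ## §4 The δ-certificate (CANDIDATE statements — the typing of R9-B2)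

Frame: a regular system of parameters `(g, u₂, u₃)` of the regular local ring `S` (dimension 3), weights `a` on `g` and `b` on
`u₂, u₃` with `0 < b < a` (slope `δ = a/b > 1`), `W n := weightedMonomialIdeal ![g, u₂, u₃] ![a, b, b] n`.  HYPOTHESES: `f ∈ W (aν)`
(every point of the Newton polyhedron `Δ(f; u; g)` has `|·| ≥ a/b`) and the **δ-face is not solvable**: no `c` and no `ψ` make
`f − c·(g − ψ)^ν ∈ W (aν + 1)`.  CONCLUSION: every admissible triple reached by `f` has `r₁/r₂ ≤ a/b`; with the flag `(g, u₂)`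
itself reaching `a/b` this gives `sigmaRatioNat f = ν!·a/b` exactly.  Informal proof (IDEAS.md §R9-B2): one-flag collapse (§2) ⇒
only one `g'` at a time matters; dichotomy (§3) ⇒ `ḡ' ∝ ḡ`, so `g' = unit·(g − ψ)`, `ψ ∈ 𝔪²`; in the graded ring of `W` the
`δ`-face form of `f` in the frame `g − ψ` is `In(f)(G + Ψ_δ)`, which is `c·G^ν` only if `In(f) = c(G − Ψ_δ)^ν` — excluded; so a
point of the `δ`-face survives and `δ(f; u; g − ψ) ≤ a/b`; `u`-independence of `δ(f;u;g')` (it is `sup {a'/b' : f ∈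
ratContactFiltration g' a' b' (a'ν)}`) finishes.  This is the hypersurface, one-frame form of Hironaka's vertex theorem
[Hironaka 1967 (4.8) as recalled in Cossart–Jannsen–Saito, LNM 2270, Def. 8.15 / Thm. 8.16, p. 121 of the held copy] — cited as
MOTIVATION only; the statement below is OURS and must be proved in the tree. -/

/-- [OURS · R9-B2 · CANDIDATE] The **δ-certificate hypotheses** in the r.s.p. frame `(u₃, u₂, g)` with weights `(b, b, a)` (the tree's
ordering of `flagContactFiltration_eq_weightedMonomialIdeal`: complementary parameter first, flag last). -/
def DeltaCertificate (f g u₂ u₃ : S) (ν a b : ℕ) : Prop :=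
  Ideal.span {u₃, u₂, g} = maximalIdeal S ∧ 0 < b ∧ b < a ∧
    f ∈ weightedMonomialIdeal ![u₃, u₂, g] ![b, b, a] (a * ν) ∧
    ∀ c ψ : S, ψ ∈ maximalIdeal S ^ 2 → f - c * (g - ψ) ^ ν ∉ weightedMonomialIdeal ![u₃, u₂, g] ![b, b, a] (a * ν + 1)

/-- [OURS · R9-B2 · CANDIDATE] The **ratio bound** concluded by the certificate: no admissible triple reached by `f` has slope
`r₁/r₂` above `a/b`. -/
def RatioBoundedBy (f : S) (ν a b : ℕ) : Prop :=
  ∀ q r₁ r₂ : ℕ, AdmissibleTriple q r₁ r₂ → FlagReaches f ν q r₁ r₂ → r₁ * b ≤ a * r₂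

/-- [OURS · R9-B2 · CANDIDATE] **The δ-certificate lemma** (to be proved by a door typer; regular local rings of dimension 3 — the
informal proof uses a coefficient field, i.e. the door's equicharacteristic case; mixed characteristic expected but unverified;
`ν = ord f`).  The upper-bound half of «`sigmaRatioNat f = ν!·a/b`». -/
def DeltaCertificateLemma : Prop :=
  ∀ (T : Type) [CommRing T] [IsRegularLocalRing T], ringKrullDim T = 3 →
    ∀ (f g u₂ u₃ : T) (ν a b : ℕ), f ∈ maximalIdeal T ^ ν → f ∉ maximalIdeal T ^ (ν + 1) →
      DeltaCertificate f g u₂ u₃ ν a b → RatioBoundedBy f ν a b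

/-- [OURS · R9-B2] The trivial direction of the certificate frame, PROVED from the tree's bridge
`flagReaches_of_mem_weightedMonomialIdeal` (res-type-060/047): `f ∈ W(aν)` in an r.s.p. frame `(u₃, u₂, g)` of a 3-dimensional regular
local ring gives the LOWER bound — the flag `(g, u₂)` reaches the admissible triple `(q; r₁, r₂) = (b; a, b)`, i.e. slope `a/b`.
[folklore] -/
theorem certificate_lowerBound {T : Type u} [CommRing T] [IsRegularLocalRing T] (hdim : ringKrullDim T = 3)
    {f g u₂ u₃ : T} {ν a b : ℕ} (h𝔪 : Ideal.span {u₃, u₂, g} = maximalIdeal T) (hb : 0 < b) (hba : b ≤ a)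
    (hf : f ∈ weightedMonomialIdeal ![u₃, u₂, g] ![b, b, a] (a * ν)) : FlagReaches f ν b a b :=
  flagReaches_of_mem_weightedMonomialIdeal hdim h𝔪 hb le_rfl hba hf

/-- [OURS · R9-B2] … so under the certificate hypotheses the slope `a/b` IS reached (`AdmissibleTriple b a b` holds), and the
certificate lemma would pin `σ₁/ν!` to exactly `a/b`. [folklore] -/
theorem DeltaCertificate.flagReaches {T : Type u} [CommRing T] [IsRegularLocalRing T] (hdim : ringKrullDim T = 3)
    {f g u₂ u₃ : T} {ν a b : ℕ} (h : DeltaCertificate f g u₂ u₃ ν a b) :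
    AdmissibleTriple b a b ∧ FlagReaches f ν b a b :=
  ⟨⟨h.2.1, le_rfl, h.2.2.1.le⟩, certificate_lowerBound hdim h.1 h.2.1 h.2.2.1.le h.2.2.2.1⟩

/-! ## §5 The arithmetic core of (o56)(b′)

Setting of (b′) at the generic point `η` of the curve `C = V(x, y)`: frame `(x, y, z)`, `f = c₀y^ν + Σ c·y^j x^i z^k`, `δ_η = r/q`
with `q ≥ 2`, `q ∤ r`, `b = ⌊r/q⌋`, `ρ = r − qb ∈ [1, q−1]`; the frame is `δ_η`-prepared: every monomial has `q·i ≥ r·(ν − j)`.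
`τ = 0` supplies a WITNESS monomial with `q·i + k < (r+1)(ν−j)`.  The t-homogeneous successor prime with a `(ν, ε)`-tie is the
origin `𝔫₀` of the `x`-chart `x = t, y = t^b Y, z = z`, where the monomial becomes `Y^j t^(i − b(ν−j)) z^k`, a point
`((i − b(ν−j))/(ν−j), k/(ν−j))` of `Δ(f₁; t, z; Y)`.  The lemmas: (i) the witness lands at `|·| < 1 + ρ/q` (`< 2`, and `≤ r/q` as
`b ≥ 1`); (ii) a monomial that could cancel a `|·|`-minimal witness of maximal `j` under a translation `Y ↦ Y − ψ`, `ψ ∈ (t, z)²`,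
is itself a witness with larger `j` — so the witness survives every frame change tangent to `Y`, and with §2–§3 the successor's
`σ₁/ν!` is `< 1 + ρ/q ≤ r/q = σ₁(η)/ν!`: **(b′) holds with the explicit margin**. -/

/-- [OURS · R9-B3 · (i)] **The witness lands low**: from `q i ≥ r m` (prepared), `q i + k < (r+1) m` (τ-witness), `q b ≤ r`
(`b = ⌊r/q⌋`) one gets `q·((i − b m) + k) < (r + q − q b)·m`, i.e. the successor point has
`|·| = ((i − bm) + k)/m < 1 + ρ/q`.  (`m = ν − j ≥ 1`.) [folklore] -/
theorem witness_lands_low {q r b i k m : ℕ} (hq : 0 < q) (hqb : q * b ≤ r) (hprep : r * m ≤ q * i)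
    (hwit : q * i + k < (r + 1) * m) (hbm : b * m ≤ i) : q * ((i - b * m) + k) < (r + q - q * b) * m := by
  obtain ⟨i', rfl⟩ : ∃ i', i = b * m + i' := ⟨i - b * m, by omega⟩
  obtain ⟨ρ, rfl⟩ : ∃ ρ, r = q * b + ρ := ⟨r - q * b, by omega⟩
  have e1 : b * m + i' - b * m = i' := by omega
  have e2 : q * b + ρ + q - q * b = ρ + q := by omega
  rw [e1, e2]
  have H1 : (q * b + ρ) * m = q * (b * m) + ρ * m := by ring
  have H2 : q * (b * m + i') = q * (b * m) + q * i' := by ring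
  have H3 : (q * b + ρ + 1) * m = q * (b * m) + ρ * m + m := by ring
  have H4 : q * (i' + k) = q * i' + q * k := by ring
  have H5 : (ρ + q) * m = ρ * m + q * m := by ring
  rw [H1, H2] at hprep
  rw [H2, H3] at hwit
  rw [H4, H5]
  have hk : k + (q * i' - ρ * m) + 1 ≤ m := by omega
  have hmul := Nat.mul_le_mul_left q hk
  have H6 : q * (k + (q * i' - ρ * m) + 1) = q * k + q * (q * i' - ρ * m) + q := by ring
  rw [H6] at hmul
  have H7 : q * i' - ρ * m ≤ q * (q * i' - ρ * m) := Nat.le_mul_of_pos_left _ hq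
  omega

/-- [OURS · R9-B3 · (i⁺) MARGIN LAW] The sharper form found by the R9 census (2376/2376 ties, 752 equalities) and then proved:
the witness point lands at value `≤ 1 + ρ/q − 1/m` (`m = ν − j⋆ ≤ ν`), i.e. `q·((i − b m) + k) + q ≤ (r + q − q b)·m` — so the successor's
ratio is `≤ 1 + frac(r/q) − 1/ν`, with equality iff `j⋆ = 0` and `q ∣ ρν` (family `y^ν + x^{rν/q} z^{ν−1}`).  Key: `k < m` is automatic
(`q i ≥ r m` and `q i + k < (r+1) m`). [folklore] -/
theorem witness_margin {q r b i k m : ℕ} (hq : 0 < q) (hqb : q * b ≤ r) (hprep : r * m ≤ q * i)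
    (hwit : q * i + k < (r + 1) * m) (hbm : b * m ≤ i) : q * ((i - b * m) + k) + q ≤ (r + q - q * b) * m := by
  obtain ⟨i', rfl⟩ : ∃ i', i = b * m + i' := ⟨i - b * m, by omega⟩
  obtain ⟨ρ, rfl⟩ : ∃ ρ, r = q * b + ρ := ⟨r - q * b, by omega⟩
  have e1 : b * m + i' - b * m = i' := by omega
  have e2 : q * b + ρ + q - q * b = ρ + q := by omega
  rw [e1, e2]
  have H1 : (q * b + ρ) * m = q * (b * m) + ρ * m := by ring
  have H2 : q * (b * m + i') = q * (b * m) + q * i' := by ring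
  have H3 : (q * b + ρ + 1) * m = q * (b * m) + ρ * m + m := by ring
  have H4 : q * (i' + k) = q * i' + q * k := by ring
  have H5 : (ρ + q) * m = ρ * m + q * m := by ring
  rw [H1, H2] at hprep
  rw [H2, H3] at hwit
  rw [H4, H5]
  have hk : k + (q * i' - ρ * m) + 1 ≤ m := by omega
  have hmul := Nat.mul_le_mul_left q hk
  have H6 : q * (k + (q * i' - ρ * m) + 1) = q * k + q * (q * i' - ρ * m) + q := by ring
  rw [H6] at hmul
  have H7 : q * i' - ρ * m ≤ q * (q * i' - ρ * m) := Nat.le_mul_of_pos_left _ hq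
  omega

/-- [OURS · R9-B3 · (i′)] … and `1 + ρ/q ≤ r/q` as soon as `b ≥ 1` (`r > q`): `r + q − q b ≤ r`. [folklore] -/
theorem low_bound_le_ratio {q r b : ℕ} (hb : 1 ≤ b) (hqb : q * b ≤ r) : r + q - q * b ≤ r := by
  have : q ≤ q * b := Nat.le_mul_of_pos_right q hb
  omega

/-- [OURS · R9-B3 · (ii)] **Low points are translation-rigid** (the cancellation count).  Points are `(j, a, c)` =
`Y^j t^a z^c` with `j < ν`, value `|·| = (a + c)/(ν − j)`; «low» means `q(a + c) < (q + ρ)(ν − j)` (i.e. `|·| < 1 + ρ/q`), and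
`ρ < q`.  If `(j⋆, a⋆, c⋆)` is low and `|·|`-minimal among the points (`(a⋆ + c⋆)(ν − j) ≤ (a + c)(ν − j⋆)` for every point), then
any point `(j, a, c)` with `j⋆ < j < ν`, `a ≤ a⋆`, `c ≤ c⋆` and `(a⋆ − a) + (c⋆ − c) ≥ 2(j − j⋆)` — the only ones whose product
with a monomial of `ψ^(j − j⋆)`, `ψ ∈ (t,z)²`, can hit `Y^{j⋆} t^{a⋆} z^{c⋆}` — does not exist.  Pure arithmetic. [folklore] -/
theorem no_canceller {q ρ ν j₀ a₀ c₀ j a c : ℕ} (hρ : ρ < q) (hj₀ : j₀ < j) (hj : j < ν)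
    (hlow : q * (a₀ + c₀) < (q + ρ) * (ν - j₀))
    (hmin : (a₀ + c₀) * (ν - j) ≤ (a + c) * (ν - j₀))
    (ha : a ≤ a₀) (hc : c ≤ c₀) (hdeg : 2 * (j - j₀) ≤ (a₀ - a) + (c₀ - c)) : False := by
  -- Write s₀ = a₀ + c₀, s = a + c, m₀ = ν − j₀, m = ν − j, d = j − j₀ = m₀ − m > 0.
  -- hdeg: s ≤ s₀ − 2d;  hmin: s₀ m ≤ s m₀;  hlow: q s₀ < (q+ρ) m₀ < 2q m₀, i.e. s₀ < 2 m₀.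
  -- Then s₀ m ≤ s m₀ ≤ (s₀ − 2d) m₀ = s₀ m₀ − 2 d m₀, so 2 d m₀ ≤ s₀ (m₀ − m) = s₀ d, so 2 m₀ ≤ s₀: contradiction.
  obtain ⟨d, hd⟩ : ∃ d, j = j₀ + d := ⟨j - j₀, by omega⟩
  subst hd
  have hdpos : 0 < d := by omega
  have hm : ν - j₀ = (ν - (j₀ + d)) + d := by omega
  set m := ν - (j₀ + d) with hm_def
  rw [hm] at hlow hmin
  have hs : a + c + 2 * d ≤ a₀ + c₀ := by omega
  have h2 : (q + ρ) * (m + d) < 2 * q * (m + d) := by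
    have : 0 < m + d := by omega
    nlinarith
  have h3 : q * (a₀ + c₀) < 2 * q * (m + d) := lt_trans hlow h2
  have h4 : a₀ + c₀ < 2 * (m + d) := by
    have hq : 0 < q := by omega
    nlinarith
  -- hmin : (a₀ + c₀) * m ≤ (a + c) * (m + d) ≤ (a₀ + c₀ − 2d)(m + d)
  have h5 : (a₀ + c₀) * m + 2 * d * (m + d) ≤ (a₀ + c₀) * (m + d) := by nlinarith
  have h6 : 2 * d * (m + d) ≤ (a₀ + c₀) * d := by nlinarith
  have h7 : 2 * (m + d) ≤ a₀ + c₀ := by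
    have := Nat.le_of_mul_le_mul_right (by nlinarith : 2 * (m + d) * d ≤ (a₀ + c₀) * d) hdpos
    exact this
  omega

/-- [OURS · R9-B3 · CANDIDATE] **The successor ratio bound of (b′)**, typed as a shape over the letters: at a local ring `S₁`
(the t-homogeneous successor germ) whose `f₁` has order `ν`, tangent cone `c₀·Ȳ^ν`-or-not, and whose frame `(Y, t, z)` carries a
low rigid witness, every admissible triple reached has `r₁·q < (q + ρ)·r₂`; hence `sigmaRatioNat f₁ < ν!·(q + ρ)/q ≤ ν!·r/q`.
The hypotheses are those §2–§3 reduce it to; the monomial bookkeeping (`Δ(f₁; t, z; Y − ψ)` keeps the witness, by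
`no_canceller`) is the part a door typer must supply over `MvPowerSeries`/the completion. -/
def SuccessorRatioBound (S₁ : Type u) [CommRing S₁] [IsLocalRing S₁] (f₁ : S₁) (ν q ρ : ℕ) : Prop :=
  ∀ q' r₁ r₂ : ℕ, AdmissibleTriple q' r₁ r₂ → FlagReaches f₁ ν q' r₁ r₂ → r₁ * q < (q + ρ) * r₂

/-- [OURS · R9-B3] **From the successor slope bound to the letter** (PROVED, `sSup` bookkeeping): if every admissible triple
reached by `f₁` (at its own order) has slope `r₁/r₂ < (q+ρ)/q`, then `σ₁(f₁)·q < ν!·(q+ρ)` — STRICT, also in the junk case (empty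
set, `σ₁ = 0`).  With `q + ρ ≤ r` (`b ≥ 1`, `low_bound_le_ratio`) and `σ₁(η)·q ≥ ν!·r` (the curve's own flag) this is the strict
σ-RATIO drop of (b′). [folklore] -/
theorem sigmaRatioNat_mul_lt_of_slope_lt {S₁ : Type u} [CommRing S₁] [IsLocalRing S₁] (f₁ : S₁) {q ρ : ℕ} (hq : 0 < q)
    (h : SuccessorRatioBound S₁ f₁ (adicOrder f₁).toNat q ρ) :
    sigmaRatioNat f₁ * q < ratioScale (adicOrder f₁).toNat * (q + ρ) := by
  set F := ratioScale (adicOrder f₁).toNat with hF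
  have hFpos : 0 < F := Nat.factorial_pos _
  set A : Set ℕ := {m : ℕ | ∃ q' r₁ r₂ : ℕ, AdmissibleTriple q' r₁ r₂ ∧ FlagReaches f₁ (adicOrder f₁).toNat q' r₁ r₂ ∧
    m * r₂ ≤ ratioScale (adicOrder f₁).toNat * r₁} with hA
  have hσ : sigmaRatioNat f₁ = sSup A := rfl
  -- every member obeys the strict bound
  have hbound : ∀ m ∈ A, m * q < F * (q + ρ) := by
    rintro m ⟨q', r₁, r₂, hadm, hfr, hm⟩
    have hr₂ : 0 < r₂ := lt_of_lt_of_le hadm.1 hadm.2.1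
    have h1 : r₁ * q < (q + ρ) * r₂ := h q' r₁ r₂ hadm hfr
    have h2 : m * q * r₂ ≤ F * (r₁ * q) := by
      have := Nat.mul_le_mul_right q hm
      calc m * q * r₂ = m * r₂ * q := by ring
        _ ≤ F * r₁ * q := this
        _ = F * (r₁ * q) := by ring
    have h3 : F * (r₁ * q) < F * ((q + ρ) * r₂) := Nat.mul_lt_mul_of_pos_left h1 hFpos
    have h4 : m * q * r₂ < F * (q + ρ) * r₂ := by
      calc m * q * r₂ < F * ((q + ρ) * r₂) := lt_of_le_of_lt h2 h3
        _ = F * (q + ρ) * r₂ := by ring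
    exact Nat.lt_of_mul_lt_mul_right h4
  by_cases hne : A.Nonempty
  · have hbdd : BddAbove A := by
      refine ⟨F * (q + ρ), fun m hm => ?_⟩
      have := hbound m hm
      calc m ≤ m * q := Nat.le_mul_of_pos_right m hq
        _ ≤ F * (q + ρ) := this.le
    rw [hσ]
    exact hbound _ (Nat.sSup_mem hne hbdd)
  · rw [Set.not_nonempty_iff_eq_empty] at hne
    rw [hσ, hne, csSup_empty, Nat.bot_eq_zero, zero_mul]
    exact Nat.mul_pos hFpos (by omega)

/-- [OURS · R9-B3] The (b′) comparison in scaled integers: successor letter `< ν!·(q+ρ)/q ≤ ν!·r/q ≤` the curve's letter. [folklore] -/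
theorem sigma_ratio_drop_of_bounds {σ₀ σ₁ F q ρ r : ℕ} (hsucc : σ₁ * q < F * (q + ρ)) (hqr : q + ρ ≤ r)
    (hcurve : F * r ≤ σ₀ * q) : σ₁ < σ₀ := by
  have h1 : F * (q + ρ) ≤ F * r := Nat.mul_le_mul_left F hqr
  have h2 : σ₁ * q < σ₀ * q := lt_of_lt_of_le hsucc (h1.trans hcurve)
  exact Nat.lt_of_mul_lt_mul_right h2

/-! ## §6 (G4) The dimension-2 bridge at the generic point `η` of the curve

At `η` the local ring `S_P` is regular of dimension `2` with regular system `(x, y)`; the curve position's own flag `(y; x)`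
reaches `(q; r, q)` as soon as `f ∈ W((x,y);(q,r); rν)·S_P` (all points of `Δ(f;x;y)` have abscissa `≥ r/q`, i.e. `δ_η ≥ r/q`).
The tree's bridge `flagReaches_of_mem_weightedMonomialIdeal` is stated for dimension `3` and a 3-frame; here is the 2-frame
version, obtained from the SAME bridge by duplicating a generator (`𝔪 = (x, x, y)`). -/

/-- `W((x,y);(q,r);n) ⊆ W((x,x,y);(q,q,r);n)` (a monomial `xᵃyᶜ` is the monomial `xᵃ·x⁰·yᶜ`). [folklore] -/
theorem weightedMonomialIdeal_pair_le_triple {A : Type u} [CommRing A] (x y : A) (q r n : ℕ) :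
    weightedMonomialIdeal ![x, y] ![q, r] n ≤ weightedMonomialIdeal ![x, x, y] ![q, q, r] n := by
  apply Ideal.span_mono
  rintro m ⟨α, hα, rfl⟩
  refine ⟨![α 0, 0, α 1], ?_, ?_⟩
  · simpa [Fin.sum_univ_two, Fin.sum_univ_three] using hα
  · simp [Fin.prod_univ_two, Fin.prod_univ_three]

/-- `Set.range ![a, b] = {a, b}`. [folklore] -/
theorem range_vec₂ {R : Type u} (a b : R) : Set.range ![a, b] = {a, b} := by
  ext t
  simp only [Set.mem_range, Set.mem_insert_iff, Set.mem_singleton_iff]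
  constructor
  · rintro ⟨i, hi⟩
    fin_cases i
    · exact Or.inl hi.symm
    · exact Or.inr hi.symm
  · rintro (h | h)
    · exact ⟨0, h.symm⟩
    · exact ⟨1, h.symm⟩

section DimTwo

variable {T : Type u} [CommRing T] [IsRegularLocalRing T]

/-- In a regular local ring of dimension `2`, `emb dim = 2`. [folklore] -/
theorem spanFinrank_eq_two_of_ringKrullDim (hdim : ringKrullDim T = 2) : (maximalIdeal T).spanFinrank = 2 := by
  have h := IsRegularLocalRing.spanFinrank_maximalIdeal (R := T)
  rw [hdim] at h
  exact_mod_cast h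

/-- The regular system `𝔪 = (a, b)` of a 2-dimensional regular local ring is a two-flag. [cite: Matsumura1987, Thm. 17.10] -/
theorem isTwoFlag_of_span_pair_eq (hdim : ringKrullDim T = 2) {a b : T} (h : Ideal.span {a, b} = maximalIdeal T) :
    IsTwoFlag a b := by
  have hd := spanFinrank_eq_two_of_ringKrullDim hdim
  have hv : Ideal.span (Set.range ![a, b]) = maximalIdeal T := by rw [range_vec₂, h]
  exact isTwoFlag_of_rsp hd ![a, b] hv (i := 0) (j := 1) (by decide)

/-- [OURS · R9 · (G4)] **The dimension-2 bridge**: in a regular local ring of dimension `2` with regular system `(x, y)`,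
`f ∈ W((x,y);(q,r); rν)` with `0 < q ≤ r` exhibits the flag `(y; x)` reaching `(q; r, q)` — so `σ₁(f)·q ≥ ν!·r` at `η`
(the `hcurve` input of `sigma_ratio_drop_of_bounds`, once `ν = ord f`). [folklore] -/
theorem flagReaches_of_mem_weightedMonomialIdeal₂ (hdim : ringKrullDim T = 2) {x y f : T} {q r ν : ℕ}
    (h𝔪 : Ideal.span {x, y} = maximalIdeal T) (hq : 0 < q) (hqr : q ≤ r)
    (hf : f ∈ weightedMonomialIdeal ![x, y] ![q, r] (r * ν)) : FlagReaches f ν q r q := by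
  have h𝔪' : Ideal.span ({x, x, y} : Set T) = maximalIdeal T := by
    rw [Set.insert_eq_of_mem (Set.mem_insert x ({y} : Set T)), h𝔪]
  refine ⟨y, x, (isTwoFlag_of_span_pair_eq hdim h𝔪).symm, ?_⟩
  rw [← mem_weightedMonomialIdeal_iff_mem_flagContactFiltration h𝔪' hq le_rfl hqr]
  exact weightedMonomialIdeal_pair_le_triple x y q r _ hf

/-- [OURS · R9 · (G4)] … hence the curve's letter at `η` in scaled integers: `ν!·r ≤ σ₁(f)·q` (`ν = ord f`), from the member
`m := (ν!/q)·r` of the `sigmaRatioNat` set (divisible case `q ∣ ν!`, which is the (b′) situation: `q ≤ ν`).  `hbdd` (the set is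
bounded — the non-junk branch of `sigmaRatioNat`, cf. tri-1 v9.10 (B.2)(b)) is kept as an explicit input; it is the `hcurve`
premise of `sigma_ratio_drop_of_bounds`. [folklore] -/
theorem ratioScale_mul_le_sigmaRatioNat_mul (hdim : ringKrullDim T = 2) {x y f : T} {q r : ℕ}
    (h𝔪 : Ideal.span {x, y} = maximalIdeal T) (hq : 0 < q) (hqr : q ≤ r) (hqν : q ∣ ratioScale (adicOrder f).toNat)
    (hf : f ∈ weightedMonomialIdeal ![x, y] ![q, r] (r * (adicOrder f).toNat))
    (hbdd : BddAbove {m : ℕ | ∃ q' r₁ r₂ : ℕ, AdmissibleTriple q' r₁ r₂ ∧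
      FlagReaches f (adicOrder f).toNat q' r₁ r₂ ∧ m * r₂ ≤ ratioScale (adicOrder f).toNat * r₁}) :
    ratioScale (adicOrder f).toNat * r ≤ sigmaRatioNat f * q := by
  obtain ⟨c, hc⟩ := hqν
  have hmem : c * r ∈ {m : ℕ | ∃ q' r₁ r₂ : ℕ, AdmissibleTriple q' r₁ r₂ ∧
      FlagReaches f (adicOrder f).toNat q' r₁ r₂ ∧ m * r₂ ≤ ratioScale (adicOrder f).toNat * r₁} :=
    ⟨q, r, q, ⟨hq, le_rfl, hqr⟩, flagReaches_of_mem_weightedMonomialIdeal₂ hdim h𝔪 hq hqr hf, by rw [hc]; ring_nf; rfl⟩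
  have hle : c * r ≤ sigmaRatioNat f := le_csSup hbdd hmem
  calc ratioScale (adicOrder f).toNat * r = c * r * q := by rw [hc]; ring
    _ ≤ sigmaRatioNat f * q := Nat.mul_le_mul_right q hle

end DimTwo

end R9

end Iota3

end Summit.ResolutionOfSingularities.ResolutionOfSingularities.Cruxes.HypersurfaceCentreConstruction.LocalEngine
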